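import Literature.MathematicalPhysics.QuantumFieldTheory.OSLogSlotAnalyticity
import Literature.Analysis.Complex.LogSectorExtension
import HarnessLib

/-!
# The logarithmic-slot engine with sector-dependent slot bounds and general opening angle

Topic `Literature/MathematicalPhysics/QuantumFieldTheory`; supplement to `OSLogSlotAnalyticity`
(the generic Osterwalder–Schrader Ch. V engine: joint analyticity in the logarithmic variables from
holomorphic slots, Osterwalder–Schrader II (Comm. Math. Phys. 42 (1975)), Ch. V p. 292, (5.7)–(5.8),
by the flat tube theorem `Literature.Analysis.Complex.exists_holomorphic_extension_l1Tube`). The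
tree's engine asks the slot functions `Eᵢ(u', τ)` to be bounded by `Cᵢ (1 + ‖u'‖)^{Nᵢ}` on the
*closed* half-plane `{Re τ ≥ 0}`. The slot continuations of the *unregularised* Schwinger functions,
`τ ↦ (Ψ(x', ·), e^{-(τ - x' - x)H} Ψ(x, ·))` ((5.4)), are not: their boundary values at `Re τ = 0`
are the (distributional) Wightman functions, and one only has bounds on the closed sectors
`{|arg τ| ≤ c}`, `c < π/2`, deteriorating as `c → π/2` (OS (6.20)). The flat tube theorem allows
exactly this (slot bounds depending on the height `c` of the closed sub-strip), so here the engine is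
re-run with

* slots holomorphic on the **open sector** `openSector a = {Re τ > 0, |arg τ| < a}` of opening
  `a ≤ π/2` and bounded by `Csecᵢ(c) (1 + ‖u'‖)^{Nᵢ}` on `{Re τ > 0, |arg τ| ≤ c}` for every `c < a`
  (`differentiableOn_slotInt_sector`, `norm_slotInt_le_sector`, `slot_log_holomorphic_sector`,
  `logT_slot_sector`);
* output: `F` holomorphic on the tube `{∑ᵢ |Im zᵢ| < a}` over the `ℓ¹`-ball of radius `a`, bounded on
  closed sub-tubes, with `F(x) = e^{-2b∑xᵢ²} S(eˣ)` at real points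
  (`exists_holomorphic_extension_logDensity_sector`), and, through
  `Literature.Analysis.Complex.logSectorExt`, a function holomorphic on the **sector region**
  `{Re wⱼ > 0, ∑ⱼ |arg wⱼ| < a}` equal to `S` at the positive real points
  (`exists_holomorphic_extension_sectorRegion`) — OS's (5.8) for opening `a`, the form needed both at
  `a = π/2` ((A₁) of Ch. V.2) and at `a < π/2` (the maximum principle on the flat tubes, Ch. VI.2).

## References

* K. Osterwalder, R. Schrader, *Axioms for Euclidean Green's functions II*, Comm. Math. Phys.
  42 (1975) 281–305, Ch. V pp. 291–292, (5.4), (5.7)–(5.8); Ch. VI.2 (6.20). [OsterwalderSchraderCMP1975]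
* H. Epstein, *Some analytic properties of scattering amplitudes in quantum field theory*,
  Brandeis Summer Institute 1965, Gordon and Breach 1966 (the flat tube theorem).
-/

noncomputable section

open MeasureTheory Set Filter Real
open _root_.Topology
open scoped NNReal SchwartzMap ContDiff

namespace Literature.MathematicalPhysics.QuantumFieldTheory.LogSlot

open Literature.Analysis.Complex

/-! ### Sectors -/

/-- The **open sector** `{Re τ > 0, |arg τ| < a}`. [folklore] -/
def openSector (a : ℝ) : Set ℂ := {τ : ℂ | 0 < τ.re ∧ |τ.arg| < a}

/-- The open sector is open (the argument is continuous off the closed negative axis). [folklore] -/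
theorem isOpen_openSector (a : ℝ) : IsOpen (openSector a) := by
  refine isOpen_iff_mem_nhds.2 fun τ hτ => ?_
  have hre : ∀ᶠ σ in 𝓝 τ, 0 < σ.re := Complex.continuous_re.continuousAt.eventually (Ioi_mem_nhds hτ.1)
  have harg : ∀ᶠ σ in 𝓝 τ, |σ.arg| < a :=
    ((Complex.continuousAt_arg (Or.inl hτ.1)).abs).eventually (Iio_mem_nhds hτ.2)
  filter_upwards [hre, harg] with σ h1 h2 using ⟨h1, h2⟩

/-- **Small balls about a point of the open sector lie in a closed sub-sector**: for `τ₀` in the open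
sector of opening `a` there are `R > 0` and `c < a` with `0 ≤ c` such that the ball `B(τ₀, R)` lies in
`{Re τ > 0, |arg τ| ≤ c}`. [folklore] -/
theorem exists_ball_subset_closedSector {a : ℝ} {τ₀ : ℂ} (hτ₀ : τ₀ ∈ openSector a) :
    ∃ R : ℝ, 0 < R ∧ ∃ c : ℝ, 0 ≤ c ∧ c < a ∧
      ∀ τ ∈ Metric.ball τ₀ R, 0 < τ.re ∧ |τ.arg| ≤ c := by
  set c : ℝ := (|τ₀.arg| + a) / 2 with hc
  have hc0 : 0 ≤ c := by have := abs_nonneg τ₀.arg; have := hτ₀.2; rw [hc]; linarith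
  have hca : c < a := by have := hτ₀.2; rw [hc]; linarith
  have hcτ : |τ₀.arg| < c := by have := hτ₀.2; rw [hc]; linarith
  have hre : ∀ᶠ σ in 𝓝 τ₀, 0 < σ.re := Complex.continuous_re.continuousAt.eventually (Ioi_mem_nhds hτ₀.1)
  have harg : ∀ᶠ σ in 𝓝 τ₀, |σ.arg| < c :=
    ((Complex.continuousAt_arg (Or.inl hτ₀.1)).abs).eventually (Iio_mem_nhds hcτ)
  obtain ⟨R, hR, hball⟩ := Metric.eventually_nhds_iff_ball.1 (hre.and harg)
  exact ⟨R, hR, c, hc0, hca, fun τ hτ => ⟨(hball τ hτ).1, (hball τ hτ).2.le⟩⟩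

/-- The exponential maps the strip `{|Im z| < a}`, `a ≤ π/2`, into the open sector of opening `a`,
with `arg (eᶻ) = Im z`. [folklore] -/
theorem exp_mem_openSector {a : ℝ} (ha : a ≤ π / 2) {z : ℂ} (hz : |z.im| < a) :
    Complex.exp z ∈ openSector a ∧ Complex.arg (Complex.exp z) = z.im := by
  have hz' : |z.im| < π / 2 := lt_of_lt_of_le hz ha
  have harg : Complex.arg (Complex.exp z) = z.im := by
    rw [Complex.arg_exp, toIocMod_eq_self]
    have := abs_lt.1 hz'
    constructor <;> linarith [Real.pi_pos]
  exact ⟨⟨exp_re_pos_of_abs_im_lt hz', by rwa [harg]⟩, harg⟩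

/-! ### The integrated slot function with sector bounds -/

section SlotInt

variable {k : ℕ} {S : (Fin (k + 1) → ℝ) → ℂ} {E : (Fin k → ℝ) → ℂ → ℂ} {i : Fin (k + 1)} {b a : ℝ}
  {Csec : ℝ → ℝ} {N : ℕ}
  (hCN : ∀ c : ℝ, c < a → ∀ (u' : Fin k → ℝ) (τ : ℂ), 0 < τ.re → |τ.arg| ≤ c →
    ‖E u' τ‖ ≤ Csec c * (1 + ‖u'‖) ^ N)

include hCN

/-- **Domination of the slot integrand on a closed sub-sector.** [folklore] -/
theorem norm_slot_integrand_le_sector (θ : Fin (k + 1) → ℝ → ℂ) {c : ℝ} (hc : c < a) {τ : ℂ}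
    (hτ : 0 < τ.re) (hτc : |τ.arg| ≤ c) (u' : Fin k → ℝ) :
    ‖(∏ j, logW b (θ (i.succAbove j)) (u' j)) * E u' τ‖ ≤
      (∏ j, ‖logW b (θ (i.succAbove j)) (u' j)‖) * (Csec c * (1 + ‖u'‖) ^ N) := by
  rw [norm_mul, norm_prod]
  exact mul_le_mul_of_nonneg_left (hCN c hc _ τ hτ hτc) (Finset.prod_nonneg fun j _ => norm_nonneg _)

/-- **Holomorphy of the integrated slot function on the open sector** (dominated holomorphic
parameter integral; the domination on a small ball comes from a closed sub-sector containing it). [cite: OsterwalderSchraderCMP1975, Ch. V eqs. (5.4), (5.7)] -/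
theorem differentiableOn_slotInt_sector (hb : 0 < b) (hCsec : ∀ c, 0 ≤ Csec c)
    (hEc : ∀ τ, Continuous fun u' => E u' τ) (hEd : ∀ u', DifferentiableOn ℂ (E u') (openSector a))
    (θ : Fin (k + 1) → 𝓢(ℝ, ℂ)) :
    DifferentiableOn ℂ (slotInt E i b fun j => ⇑(θ j)) (openSector a) := by
  set U : Set ℂ := openSector a with hU
  set F : ℂ → (Fin k → ℝ) → ℂ := fun τ u' => (∏ j, logW b (θ (i.succAbove j)) (u' j)) * E u' τ with hF
  have hslot : (slotInt E i b fun j => ⇑(θ j)) = fun τ => ∫ u', F τ u' := rfl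
  rw [hslot]
  have hmeas : ∀ τ ∈ U, AEStronglyMeasurable (F τ) volume := fun τ _ =>
    aestronglyMeasurable_slot_integrand hEc θ τ
  have hdiff : ∀ᵐ u' ∂(volume : Measure (Fin k → ℝ)), DifferentiableOn ℂ (fun τ => F τ u') U :=
    Eventually.of_forall fun u' =>
      (differentiableOn_const (∏ j, logW b (θ (i.succAbove j)) (u' j))).mul (hEd u')
  have hdom : ∀ τ₀ ∈ U, ∃ R : ℝ, 0 < R ∧ Metric.ball τ₀ R ⊆ U ∧ ∃ bound : (Fin k → ℝ) → ℝ,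
      Integrable bound volume ∧ ∀ᵐ u' ∂(volume : Measure (Fin k → ℝ)), ∀ τ ∈ Metric.ball τ₀ R,
        ‖F τ u'‖ ≤ bound u' := by
    intro τ₀ hτ₀
    obtain ⟨R, hR, c, -, hca, hball⟩ := exists_ball_subset_closedSector hτ₀
    exact ⟨R, hR, fun τ hτ => ⟨(hball τ hτ).1, (hball τ hτ).2.trans_lt hca⟩,
      fun u' => (∏ j, ‖logW b (θ (i.succAbove j)) (u' j)‖) * (Csec c * (1 + ‖u'‖) ^ N),
      integrable_prod_norm_logW_mul_pow hb θ (hCsec c) N,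
      Eventually.of_forall fun u' τ hτ =>
        norm_slot_integrand_le_sector hCN (fun j => ⇑(θ j)) hca (hball τ hτ).1 (hball τ hτ).2 u'⟩
  exact Literature.Analysis.Complex.differentiableOn_integral_of_dominated hmeas hdiff hdom

/-- **Bound of the integrated slot function on a closed sub-sector**: `‖Qᵢ(τ)‖ ≤ Bᵢ(θ, c)`. [folklore] -/
theorem norm_slotInt_le_sector (hb : 0 < b) (hCsec : ∀ c, 0 ≤ Csec c) (θ : Fin (k + 1) → 𝓢(ℝ, ℂ))
    {c : ℝ} (hc : c < a) {τ : ℂ} (hτ : 0 < τ.re) (hτc : |τ.arg| ≤ c) :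
    ‖slotInt E i b (fun j => ⇑(θ j)) τ‖ ≤ slotB i b (Csec c) N fun j => ⇑(θ j) :=
  norm_integral_le_of_norm_le (integrable_prod_norm_logW_mul_pow hb θ (hCsec c) N)
    (Eventually.of_forall fun u' => norm_slot_integrand_le_sector hCN (fun j => ⇑(θ j)) hc hτ hτc u')

/-- **The slot function in the logarithmic variable, `gᵢ(z) = Qᵢ(eᶻ)`, is holomorphic in the strip
`{|Im z| < a}` (`a ≤ π/2`) and bounded by `Bᵢ(θ, c⁺)` on the closed sub-strip `{|Im z| ≤ c}`,
`c < a`.** [cite: OsterwalderSchraderCMP1975, Ch. V p. 292] -/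
theorem slot_log_holomorphic_sector (hb : 0 < b) (hCsec : ∀ c, 0 ≤ Csec c) (ha0 : 0 < a) (ha : a ≤ π / 2)
    (hEc : ∀ τ, Continuous fun u' => E u' τ) (hEd : ∀ u', DifferentiableOn ℂ (E u') (openSector a))
    (θ : Fin (k + 1) → 𝓢(ℝ, ℂ)) :
    DifferentiableOn ℂ (fun z => slotInt E i b (fun j => ⇑(θ j)) (Complex.exp z)) {z : ℂ | |z.im| < a} ∧
      ∀ c : ℝ, c < a → ∀ z : ℂ, |z.im| ≤ c →
        ‖slotInt E i b (fun j => ⇑(θ j)) (Complex.exp z)‖ ≤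
          slotB i b (Csec (max c 0)) N (fun j => ⇑(θ j)) * Real.exp (0 * |z.re|) := by
  refine ⟨(differentiableOn_slotInt_sector hCN hb hCsec hEc hEd θ).comp
    Complex.differentiable_exp.differentiableOn fun z hz => (exp_mem_openSector ha hz).1, fun c hc z hz => ?_⟩
  rw [zero_mul, Real.exp_zero, mul_one]
  have hc' : max c 0 < a := max_lt hc ha0
  have hz' : |z.im| < a := lt_of_le_of_lt (hz.trans (le_max_left c 0)) hc'
  obtain ⟨hmem, harg⟩ := exp_mem_openSector ha hz'
  exact norm_slotInt_le_sector hCN hb hCsec θ hc' hmem.1 (by rw [harg]; exact hz.trans (le_max_left _ _))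

end SlotInt

/-! ### The theorem with sector bounds -/

section Main

variable {k : ℕ} (S : (Fin (k + 1) → ℝ) → ℂ) (E : Fin (k + 1) → (Fin k → ℝ) → ℂ → ℂ) {b a : ℝ}
  (hb : 0 < b) (ha0 : 0 < a) (ha : a ≤ π / 2)
  (hSc : Continuous S) {C₀ : ℝ} {N₀ : ℕ} (hSb : ∀ u, ‖S u‖ ≤ C₀ * (1 + ‖u‖) ^ N₀)
  (hEc : ∀ i τ, Continuous fun u' => E i u' τ)
  (hEd : ∀ i u', DifferentiableOn ℂ (E i u') (openSector a))
  (Csec : Fin (k + 1) → ℝ → ℝ) (N : Fin (k + 1) → ℕ) (hCsec : ∀ i c, 0 ≤ Csec i c)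
  (hCN : ∀ (i : Fin (k + 1)) (c : ℝ), c < a → ∀ (u' : Fin k → ℝ) (τ : ℂ), 0 < τ.re → |τ.arg| ≤ c →
    ‖E i u' τ‖ ≤ Csec i c * (1 + ‖u'‖) ^ N i)
  (hES : ∀ i (u' : Fin k → ℝ), (∀ j, 0 ≤ u' j) → ∀ x : ℝ, 0 ≤ x → E i u' x = S (i.insertNth x u'))

include hb ha0 ha hSc hSb hEc hEd hCsec hCN hES

/-- **The slot representations of the functional, with sector bounds** (hypothesis `hT` of the flat
tube theorem at height `a`). [cite: OsterwalderSchraderCMP1975, Ch. V p. 292] -/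
theorem logT_slot_sector (i : Fin (k + 1)) (θ : Fin (k + 1) → 𝓢(ℝ, ℂ)) :
    ∃ g : ℂ → ℂ, DifferentiableOn ℂ g {z : ℂ | |z.im| < a} ∧
      (∀ c : ℝ, c < a → ∀ z : ℂ, |z.im| ≤ c →
        ‖g z‖ ≤ slotB i b (Csec i (max c 0)) (N i) (fun j => ⇑(θ j)) * Real.exp (0 * |z.re|)) ∧
      ∀ ϑ : 𝓢(ℝ, ℂ), logT S b (Function.update (fun j => ⇑(θ j)) i ϑ) =
        ∫ s : ℝ, g s * Complex.exp (-(b : ℂ) * (s : ℂ) ^ 2) * ϑ s := by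
  obtain ⟨hdiff, hbound⟩ := slot_log_holomorphic_sector (hCN i) hb (hCsec i) ha0 ha (hEc i) (hEd i) θ
  refine ⟨_, hdiff, hbound, fun ϑ => ?_⟩
  rw [logT_update_eq_integral_integral i hb hSc hSb θ ϑ]
  have h1 : (fun x : ℝ => logW b ϑ x * ∫ u' : Fin k → ℝ, (∏ j, logW b (θ (i.succAbove j)) (u' j)) *
      S (i.insertNth x u')) =
      fun x => logW b ϑ x * slotInt (E i) i b (fun j => ⇑(θ j)) x := by
    funext x
    rcases le_or_gt x 0 with hx | hx
    · rw [logW_of_nonpos hx, zero_mul, zero_mul]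
    · rw [integral_prod_logW_mul_eq_slotInt (hES i) (fun j => ⇑(θ j)) hx.le]
  rw [h1, integral_logW_mul_eq]
  refine integral_congr_ae (Eventually.of_forall fun s => ?_)
  beta_reduce
  rw [Complex.ofReal_exp]

/-- **Joint analyticity in the logarithmic variables, functional form, height `a`**: there is `F`
holomorphic on `{∑ᵢ |Im zᵢ| < a}`, bounded on closed sub-tubes, representing the functional. [cite: OsterwalderSchraderCMP1975, Ch. V pp. 291–292] -/
theorem exists_holomorphic_logT_sector :
    ∃ F : (Fin (k + 1) → ℂ) → ℂ,
      DifferentiableOn ℂ F {z : Fin (k + 1) → ℂ | ∑ j, |(z j).im| < a} ∧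
      (∀ c : ℝ, c < a → ∃ K : ℝ, ∀ z : Fin (k + 1) → ℂ, ∑ j, |(z j).im| ≤ c → ‖F z‖ ≤ K) ∧
      ∀ ϑ : Fin (k + 1) → 𝓢(ℝ, ℂ),
        logT S b (fun j (s : ℝ) => Complex.exp (-(b : ℂ) * (s : ℂ) ^ 2) * ϑ j s) =
          ∫ x : Fin (k + 1) → ℝ, F (fun j => (x j : ℂ)) * ∏ j, ϑ j (x j) :=
  Literature.Analysis.Complex.exists_holomorphic_extension_l1Tube (a := a) ha0 hb
    (logT S b) (fun i θ c => slotB i b (Csec i (max c 0)) (N i) θ)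
    (fun i θ => logT_slot_sector S E hb ha0 ha hSc hSb hEc hEd Csec N hCsec hCN hES i θ)
    fun c _ => ⟨(Finset.univ : Finset (Fin (k + 1))).sup' Finset.univ_nonempty fun i =>
        slotB i b (Csec i (max c 0)) (N i) fun _ (s : ℝ) => Complex.exp (-(b : ℂ) * (s : ℂ) ^ 2), 0,
      fun i p => by
        rw [slotB_gaussMod_eq, pow_zero, mul_one]
        exact Finset.le_sup' (fun i => slotB i b (Csec i (max c 0)) (N i) fun _ (s : ℝ) =>
          Complex.exp (-(b : ℂ) * (s : ℂ) ^ 2)) (Finset.mem_univ i)⟩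

/-- **Joint analyticity in the logarithmic variables from holomorphic slots with sector bounds**:
there is `F` holomorphic on `{∑ᵢ |Im zᵢ| < a}`, bounded on every closed sub-tube, with
`F(x) = e^{-2b∑xᵢ²} S(eˣ)` at real points. [cite: OsterwalderSchraderCMP1975, Ch. V eqs. (5.7)–(5.8)] -/
theorem exists_holomorphic_extension_logDensity_sector :
    ∃ F : (Fin (k + 1) → ℂ) → ℂ,
      DifferentiableOn ℂ F {z : Fin (k + 1) → ℂ | ∑ j, |(z j).im| < a} ∧
      (∀ c : ℝ, c < a → ∃ K : ℝ, ∀ z : Fin (k + 1) → ℂ, ∑ j, |(z j).im| ≤ c → ‖F z‖ ≤ K) ∧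
      ∀ x : Fin (k + 1) → ℝ, F (fun j => (x j : ℂ)) = logDensity S b x := by
  obtain ⟨F, hF, hK, hT⟩ := exists_holomorphic_logT_sector S E hb ha0 ha hSc hSb hEc hEd Csec N hCsec hCN hES
  refine ⟨F, hF, hK, fun x₀ => ?_⟩
  set ι : (Fin (k + 1) → ℝ) → (Fin (k + 1) → ℂ) := fun x j => (x j : ℂ) with hι
  have hιc : Continuous ι := continuous_pi fun j => Complex.continuous_ofReal.comp (continuous_apply j)
  have hιmem : ∀ x, ι x ∈ {z : Fin (k + 1) → ℂ | ∑ j, |(z j).im| < a} := fun x => by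
    simp only [hι, mem_setOf_eq, Complex.ofReal_im, abs_zero, Finset.sum_const_zero]
    exact ha0
  have hFc : Continuous fun x => F (ι x) := hF.continuousOn.comp_continuous hιc hιmem
  obtain ⟨K, hK0⟩ := hK 0 ha0
  have hFb : ∀ x, ‖F (ι x)‖ ≤ |K| * (1 + ‖x‖) ^ 0 := fun x => by
    rw [pow_zero, mul_one]
    refine (hK0 _ ?_).trans (le_abs_self K)
    simp [hι]
  have hC0' : ∀ u, ‖S u‖ ≤ |C₀| * (1 + ‖u‖) ^ N₀ := fun u =>
    (hSb u).trans (mul_le_mul_of_nonneg_right (le_abs_self _) (by positivity))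
  have hDb : ∀ x, ‖logDensity S b x‖ ≤
      |C₀| * (2 : ℝ) ^ N₀ * Real.exp (((N₀ : ℝ)) ^ 2 / (4 * (2 * b))) * (1 + ‖x‖) ^ 0 := by
    intro x
    rw [pow_zero, mul_one, logDensity, norm_mul, Complex.norm_exp]
    have hre : (-(2 * b : ℂ) * ∑ i, (x i : ℂ) ^ 2).re = -(2 * b) * ∑ i, (x i) ^ 2 := by
      have : (-(2 * b : ℂ) * ∑ i, (x i : ℂ) ^ 2) = ((-(2 * b) * ∑ i, (x i) ^ 2 : ℝ) : ℂ) := by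
        push_cast; ring
      rw [this, Complex.ofReal_re]
    rw [hre]
    refine (mul_le_mul_of_nonneg_left (hC0' (expPi x)) (Real.exp_pos _).le).trans ?_
    have hE : ‖expPi x‖ ≤ Real.exp ‖x‖ := by
      refine (pi_norm_le_iff_of_nonneg (Real.exp_pos _).le).2 fun i => ?_
      rw [expPi, Real.norm_eq_abs, abs_of_pos (Real.exp_pos _)]
      exact Real.exp_le_exp.2 ((le_abs_self _).trans (by rw [← Real.norm_eq_abs]; exact norm_le_pi_norm x i))
    have hsum : ‖x‖ ^ 2 ≤ ∑ i, (x i) ^ 2 := by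
      obtain ⟨i, -, hi⟩ := Finset.exists_max_image Finset.univ (fun i => |x i|) Finset.univ_nonempty
      have hxi : ‖x‖ ≤ |x i| := (pi_norm_le_iff_of_nonneg (abs_nonneg _)).2 fun j => by
        rw [Real.norm_eq_abs]; exact hi j (Finset.mem_univ j)
      calc ‖x‖ ^ 2 ≤ |x i| ^ 2 := pow_le_pow_left₀ (norm_nonneg _) hxi 2
        _ = x i ^ 2 := sq_abs _
        _ ≤ ∑ j, x j ^ 2 := Finset.single_le_sum (f := fun j => x j ^ 2) (fun j _ => sq_nonneg _)
            (Finset.mem_univ i)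
    have h1 : Real.exp (-(2 * b) * ∑ i, x i ^ 2) ≤ Real.exp (-(2 * b) * ‖x‖ ^ 2) :=
      Real.exp_le_exp.2 (by nlinarith)
    have h2 : (1 + ‖expPi x‖) ^ N₀ ≤ (2 : ℝ) ^ N₀ * Real.exp ((N₀ : ℝ) * ‖x‖) := by
      have h3 : 1 + ‖expPi x‖ ≤ 2 * Real.exp ‖x‖ := by
        have := Real.one_le_exp (norm_nonneg x); linarith
      calc (1 + ‖expPi x‖) ^ N₀ ≤ (2 * Real.exp ‖x‖) ^ N₀ := pow_le_pow_left₀ (by positivity) h3 N₀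
        _ = (2 : ℝ) ^ N₀ * Real.exp ((N₀ : ℝ) * ‖x‖) := by
            rw [mul_pow, ← Real.exp_nat_mul]
    have h4 := exp_neg_mul_sq_mul_exp_le (by positivity : 0 < 2 * b) (N₀ : ℝ) ‖x‖
    calc Real.exp (-(2 * b) * ∑ i, x i ^ 2) * (|C₀| * (1 + ‖expPi x‖) ^ N₀)
        ≤ Real.exp (-(2 * b) * ‖x‖ ^ 2) * (|C₀| * ((2 : ℝ) ^ N₀ * Real.exp ((N₀ : ℝ) * ‖x‖))) := by gcongr
      _ = |C₀| * (2 : ℝ) ^ N₀ * (Real.exp (-(2 * b) * ‖x‖ ^ 2) * Real.exp ((N₀ : ℝ) * ‖x‖)) := by ring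
      _ ≤ |C₀| * (2 : ℝ) ^ N₀ * Real.exp ((N₀ : ℝ) ^ 2 / (4 * (2 * b))) := by gcongr
  have hdiff : ∀ ϑ : Fin (k + 1) → 𝓢(ℝ, ℂ),
      ∫ x : Fin (k + 1) → ℝ, (F (ι x) - logDensity S b x) * ∏ i, ϑ i (x i) = 0 := by
    intro ϑ
    have hi1 := Literature.Analysis.Complex.integrable_mul_prod_schwartz hFc hFb ϑ
    have hi2 := Literature.Analysis.Complex.integrable_mul_prod_schwartz (continuous_logDensity hSc) hDb ϑ
    simp_rw [sub_mul]
    rw [integral_sub hi1 hi2, ← hT ϑ, logT_gaussian_mul_eq_integral_logDensity, sub_self]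
  have h := eq_zero_of_forall_integral_mul_prod_schwartz_eq_zero (hFc.sub (continuous_logDensity hSc)) hdiff x₀
  exact sub_eq_zero.1 h

/-- **Osterwalder–Schrader's (5.8) with opening `a`: the holomorphic extension to the sector region.**
Under the hypotheses of the section there is `G` holomorphic on the sector region
`{Re wⱼ > 0, ∑ⱼ |arg wⱼ| < a}` with `G(u) = S(u)` at every point `u` of the open positive orthant. [cite: OsterwalderSchraderCMP1975, Ch. V eq. (5.8)] -/
theorem exists_holomorphic_extension_sectorRegion :
    ∃ G : (Fin (k + 1) → ℂ) → ℂ, DifferentiableOn ℂ G (sectorRegion k a) ∧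
      ∀ u : Fin (k + 1) → ℝ, (∀ j, 0 < u j) → G (fun j => (u j : ℂ)) = S u := by
  obtain ⟨F, hF, -, hFx⟩ :=
    exists_holomorphic_extension_logDensity_sector S E hb ha0 ha hSc hSb hEc hEd Csec N hCsec hCN hES
  refine ⟨logSectorExt b F, differentiableOn_logSectorExt b hF, fun u hu => logSectorExt_ofReal b ?_ hu⟩
  intro x
  rw [hFx]
  rfl

end Main

end Literature.MathematicalPhysics.QuantumFieldTheory.LogSlot
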